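import Mathlib
import Literature.Probability.LatticeModels.GKSInequalities
import Literature.Probability.LatticeModels.IsingInverseMCertificate
import Literature.Probability.LatticeModels.IsingInverseMCertificateSound
import Literature.Probability.LatticeModels.IsingInverseMCertificateSym
import HarnessLib

/-!
# Self-computing inverse-M certificates (`IsingPolynomial.checkAuto`)

`checkSym` needs the certificate matrix `B(v) = adj M(v)/g` as data, which for graphs with a dozen
or more vertices is hundreds of kilobytes of coefficients.  `checkAuto n E rows gens coset` COMPUTES
the certificate inside Lean and then runs `checkSym` on it, so that a certificate file only carries
the graph, its automorphism generators and coset representatives (it is meant for `native_decide`;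
the kernel cannot afford the computation).  Computation: the rows `rows` of the Edwards–Sokal matrix
by an in-place histogram enumeration (`entryA`, proved to evaluate like `entry`); the full matrix assembled through the coset maps
(`M[p][q] = M[rep p][ρ_p⁻¹ q]`); at the integer points `x = 0, …, N` (`N = n·|E| ≥ deg det M`) the
determinant and the adjugate columns `adj M(x)·e_r`, `r ∈ rows`, by Montante's fraction-free
Gauss–Jordan elimination (Bareiss 1968; all divisions exact); the polynomials `det M(v)` and
`(adj M(v))_{i r}` by Newton forward-difference interpolation (exact: `N!·P` is accumulated over the
falling-factorial basis and divided by `N!` at the end); finally `B[p][q] := adj[ρ_p⁻¹ q][rep p]`.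
NOTHING about this computation is proved: `checkSymCore` verifies the identity `M·B = d·1` on the rows,
the invariance of `B` under the generators, the coverage of all rows and the coefficient signs, so
soundness (`inv_entry_nonpos_of_checkAuto`) is `inv_entry_nonpos_of_checkSymCore` plus the fact that the
row table is built from `entryA`, which evaluates like `entry` (`leval_entryA`).
[cite: FriedliVelenik2017, §3.8.1]
-/

namespace Literature.Probability.LatticeModels

namespace IsingPolynomial

/-! ### Histogram enumeration of one Edwards–Sokal entry (native use only) -/

/-- Add `x` to the `s`-th counter (no-op out of range). [folklore] -/
def addAt : List ℤ → ℕ → ℤ → List ℤ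
  | [], _, _ => []
  | c :: cs, 0, x => (c + x) :: cs
  | c :: cs, s + 1, x => c :: addAt cs s x

/-- Histogram loop over the configurations `k, k+1, …` (fuel-bounded), list version (the
specification): counter `sat k` accumulates `σ_pσ_q`. [folklore] -/
def histLoop (sat : ℕ → ℕ) (p q : ℕ) : ℕ → ℕ → List ℤ → List ℤ
  | 0, _, h => h
  | fuel + 1, k, h => histLoop sat p q fuel (k + 1) (addAt h (sat k) (spinOfF k p * spinOfF k q))

/-- `addAt` on an array, in place. [folklore] -/
def addAtA (H : Array ℤ) (s : ℕ) (x : ℤ) : Array ℤ := H.setIfInBounds s (H.getD s 0 + x)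

/-- Histogram loop, array version (the one that runs). [folklore] -/
def histLoopA (sat : ℕ → ℕ) (p q : ℕ) : ℕ → ℕ → Array ℤ → Array ℤ
  | 0, _, H => H
  | fuel + 1, k, H => histLoopA sat p q fuel (k + 1) (addAtA H (sat k) (spinOfF k p * spinOfF k q))

/-- `∑_s h[s] · (1+v)^(s₀+s)` as a coefficient list. [folklore] -/
def histPoly : List ℤ → ℕ → List ℤ
  | [], _ => []
  | c :: cs, s => ladd (lsmul c (onePlusPow s)) (histPoly cs (s + 1))

/-- The satisfied-edge counts of all configurations `k < 2^n`, computed once. [folklore] -/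
def satArray (n : ℕ) (E : List (ℕ × ℕ)) : Array ℕ := Array.ofFn (n := 2 ^ n) fun i => satCountF i.1 E

/-- The Edwards–Sokal entry `M_{pq}(v)` by an in-place histogram of satisfied-edge counts read from
the table `sats` (meant to be `satArray n E`; evaluates like `entry`, see `leval_entryA`). [folklore] -/
def entryA (n : ℕ) (E : List (ℕ × ℕ)) (sats : Array ℕ) (p q : ℕ) : List ℤ :=
  histPoly (histLoopA (fun k => sats.getD k 0) p q (2 ^ n) 0
    (Array.replicate (E.length + 1) 0)).toList 0

section HistogramCorrect

variable {R : Type*} [CommRing R]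

/-- `∑_s h[s] (1+v)^s`, Horner form. [folklore] -/
def histVal : List ℤ → R → R
  | [], _ => 0
  | c :: cs, v => (c : R) + (1 + v) * histVal cs v

/-- Effect of `addAt` on the weighted sum. [folklore] -/
theorem histVal_addAt (v : R) : ∀ (h : List ℤ) (s : ℕ) (x : ℤ), s < h.length →
    histVal (addAt h s x) v = histVal h v + (x : R) * (1 + v) ^ s := by
  intro h
  induction h with
  | nil => intro s x hs; simp at hs
  | cons c cs ih =>
    intro s x hs
    cases s with
    | zero => simp only [addAt, histVal, Int.cast_add, pow_zero]; ring
    | succ s =>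
      have hs' : s < cs.length := by simpa using hs
      simp only [addAt, histVal, ih s x hs', pow_succ]; ring

/-- `addAt` preserves the length. [folklore] -/
theorem length_addAt : ∀ (h : List ℤ) (s : ℕ) (x : ℤ), (addAt h s x).length = h.length := by
  intro h
  induction h with
  | nil => intro s x; rfl
  | cons c cs ih => intro s x; cases s <;> simp [addAt, ih]

/-- `addAt` is `List.set` at the shifted value. [folklore] -/
theorem addAt_eq_set : ∀ (h : List ℤ) (s : ℕ) (x : ℤ), addAt h s x = h.set s (h.getD s 0 + x) := by
  intro h
  induction h with
  | nil => intro s x; simp [addAt]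
  | cons c cs ih => intro s x; cases s <;> simp [addAt, ih]

/-- The array update agrees with the list update. [folklore] -/
theorem toList_addAtA (H : Array ℤ) (s : ℕ) (x : ℤ) : (addAtA H s x).toList = addAt H.toList s x := by
  rw [addAt_eq_set, addAtA, Array.toList_setIfInBounds]
  congr 2
  simp [List.getD_eq_getElem?_getD]

/-- The array loop agrees with the list loop. [folklore] -/
theorem toList_histLoopA (sat : ℕ → ℕ) (p q : ℕ) :
    ∀ (fuel k : ℕ) (H : Array ℤ),
      (histLoopA sat p q fuel k H).toList = histLoop sat p q fuel k H.toList := by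
  intro fuel
  induction fuel with
  | zero => intro k H; rfl
  | succ fuel ih => intro k H; rw [histLoopA, histLoop, ih, toList_addAtA]

/-- The histogram loop adds `σ_pσ_q (1+v)^{sat}` for each configuration visited, provided the table
`sat` is correct on the visited range. [folklore] -/
theorem histVal_histLoop (v : R) (E : List (ℕ × ℕ)) (sat : ℕ → ℕ) (p q : ℕ) :
    ∀ (fuel k : ℕ) (h : List ℤ), h.length = E.length + 1 →
      (∀ j, k ≤ j → j < k + fuel → sat j = satCount j E) →
      histVal (histLoop sat p q fuel k h) v = histVal h v +
        ∑ j ∈ Finset.range fuel, ((spinOf (k + j) p * spinOf (k + j) q : ℤ) : R) *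
          (1 + v) ^ satCount (k + j) E := by
  intro fuel
  induction fuel with
  | zero => intro k h _ _; simp [histLoop]
  | succ fuel ih =>
    intro k h hl hsat
    have hk : sat k = satCount k E := hsat k le_rfl (by omega)
    rw [histLoop, ih (k + 1) _ (by rw [length_addAt, hl]) (fun j hj1 hj2 => hsat j (by omega) (by omega)),
      histVal_addAt v h _ _ (by rw [hl, hk]; exact Nat.lt_succ_of_le (satCount_le k E)),
      Finset.sum_range_succ', hk, spinOfF_eq, spinOfF_eq]
    simp only [add_zero, Nat.add_succ, Nat.succ_add]
    ring

/-- `histPoly h s₀` evaluates to `(1+v)^{s₀} · ∑_s h[s](1+v)^s`. [folklore] -/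
theorem leval_histPoly (v : R) : ∀ (h : List ℤ) (s : ℕ),
    leval (histPoly h s) v = (1 + v) ^ s * histVal h v := by
  intro h
  induction h with
  | nil => intro s; simp [histPoly, histVal]
  | cons c cs ih =>
    intro s
    rw [histPoly, leval_ladd, leval_lsmul, leval_onePlusPow, ih (s + 1), histVal, pow_succ]
    ring

/-- The table of satisfied-edge counts is correct. [folklore] -/
theorem satArray_getD {n : ℕ} {E : List (ℕ × ℕ)} {k : ℕ} (hk : k < 2 ^ n) :
    (satArray n E).getD k 0 = satCount k E := by
  simp [satArray, hk, satCountF_eq]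

/-- **The in-place histogram enumeration is correct**: `entryA … (satArray n E)` evaluates like
`entry`. [folklore] -/
theorem leval_entryA (n : ℕ) (E : List (ℕ × ℕ)) (p q : ℕ) (v : ℝ) :
    leval (entryA n E (satArray n E) p q) v = leval (entry n E p q) v := by
  rw [entryA, toList_histLoopA, Array.toList_replicate, leval_histPoly,
    histVal_histLoop v E _ p q (2 ^ n) 0 _ (by simp)
      (fun j _ hj => satArray_getD (by simpa using hj)),
    entry, leval_cfgSum]
  have h0 : histVal (List.replicate (E.length + 1) (0 : ℤ)) v = 0 := by
    generalize E.length + 1 = L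
    induction L with
    | zero => rfl
    | succ L ih => simp [List.replicate_succ, histVal, ih]
  rw [h0]
  simp only [pow_zero, one_mul, zero_add, mul_zero, leval_term]

end HistogramCorrect

/-! ### Exact integer linear algebra at a point: Montante's method -/

/-- One Montante (Bareiss–Gauss–Jordan) step at pivot row `k` with previous pivot `pprev`:
`a_ij ← (a_kk a_ij − a_ik a_kj) / pprev` for `i ≠ k` (exact division), row `k` unchanged. [folklore] -/
def montanteStep (k : ℕ) (pprev : ℤ) (A : List (List ℤ)) : List (List ℤ) :=
  let rowk := A.getD k []
  let akk := rowk.getD k 0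
  A.mapIdx fun i row =>
    if i = k then row
    else
      let aik := row.getD k 0
      List.zipWith (fun aij akj => (akk * aij - aik * akj) / pprev) row rowk

/-- The Montante loop over the pivots `k, k+1, …` (fuel = number of remaining pivots). [folklore] -/
def montanteLoop : ℕ → ℕ → ℤ → List (List ℤ) → List (List ℤ)
  | 0, _, _, A => A
  | fuel + 1, k, pprev, A =>
    let akk := (A.getD k []).getD k 0
    montanteLoop fuel (k + 1) akk (montanteStep k pprev A)

/-- For an `n × n` integer matrix `M` and row indices `cols`, Montante elimination of
`[M | e_{r₁} ⋯ e_{r_t}]` returns `(det M, [adj(M)·e_{r_j}]_j)` (each column as the list of its `n`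
entries). [folklore] -/
def detAdjCols (n : ℕ) (M : List (List ℤ)) (cols : List ℕ) : ℤ × List (List ℤ) :=
  let aug := M.mapIdx fun i row => row ++ cols.map fun r => if i = r then (1 : ℤ) else 0
  let R := montanteLoop n 0 1 aug
  ((R.getD 0 []).getD 0 0, (List.range cols.length).map fun j => R.map fun row => row.getD (n + j) 0)

/-! ### Exact interpolation at the points `0, 1, …, N` -/

/-- Drop trailing zero coefficients. [folklore] -/
def ltrim (p : List ℤ) : List ℤ := (p.reverse.dropWhile fun c => c == 0).reverse

/-- Forward differences `[Δ⁰f(0), Δ¹f(0), …]` of a list of values `[f(0), f(1), …]` (fuel-bounded). [folklore] -/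
def fwdDiffs : ℕ → List ℤ → List ℤ
  | 0, _ => []
  | fuel + 1, vals =>
    match vals with
    | [] => []
    | v :: rest => v :: fwdDiffs fuel (List.zipWith (fun a b => b - a) vals rest)

/-- Accumulate `∑_k Δᵏf(0) · (N!/k!) · x(x-1)⋯(x-k+1)` over the remaining differences
(arguments: differences, `k`, `N!/k!`, the falling factorial `ff_k`, accumulator). [folklore] -/
def newtonAccum : List ℤ → ℕ → ℤ → List ℤ → List ℤ → List ℤ
  | [], _, _, _, acc => acc
  | dk :: ds, k, ck, ffk, acc =>
    newtonAccum ds (k + 1) (ck / ((k : ℤ) + 1)) (ladd (0 :: ffk) (lsmul (-(k : ℤ)) ffk))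
      (ladd acc (lsmul (dk * ck) ffk))

/-- The integer polynomial through the values `vals = [f(0), …, f(N)]` (assuming one of degree `≤ N`
with integer coefficients exists): Newton's forward-difference formula, scaled by `N!`. [folklore] -/
def interpolate0N (vals : List ℤ) : List ℤ :=
  let N := vals.length - 1
  let fact : ℤ := ((List.range N).map fun i => (i : ℤ) + 1).prod
  let S := newtonAccum (fwdDiffs (N + 1) vals) 0 fact [1] []
  ltrim (S.map fun c => c / fact)

/-! ### The self-computing checker -/

/-- The table of rows `rows` of the Edwards–Sokal matrix (other rows empty), by the fast
in-place histogram enumeration `entryA` (one table of satisfied-edge counts per graph). [folklore] -/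
def rowTable (n : ℕ) (E : List (ℕ × ℕ)) (rows : List ℕ) : List (List (List ℤ)) :=
  let sats := satArray n E
  (List.range n).map fun p => if p ∈ rows then (List.range n).map fun q => entryA n E sats p q else []

/-- The rows of `rowTable` evaluate to the true Edwards–Sokal rows. [folklore] -/
theorem leval_getPoly_rowTable {n : ℕ} {E : List (ℕ × ℕ)} {rows : List ℕ} {p q : ℕ}
    (hp : p ∈ rows) (hpn : p < n) (hq : q < n) (v : ℝ) :
    leval (getPoly (rowTable n E rows) p q) v = leval (entry n E p q) v := by
  have h1 : (rowTable n E rows).getD p [] =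
      (List.range n).map fun q => entryA n E (satArray n E) p q := by
    rw [rowTable, List.getD_eq_getElem _ _ (by simpa using hpn)]
    simp [hp]
  rw [getPoly, h1, List.getD_eq_getElem _ _ (by simpa using hq)]
  simp [leval_entryA]

/-- Compute the rest of the `checkSymCore` certificate `(Bcls, Bidx, d)` of the graph `(Fin n, E)`
from the row table `Mtab` and the coset data `coset[p] = (j, ρ_p⁻¹)` (meaning: `ρ_p` is an
automorphism with `ρ_p (rows[j]) = p`, given by the image list of its inverse).  See the module
docstring. [folklore] -/
def autoCert (n : ℕ) (E : List (ℕ × ℕ)) (rows : List ℕ) (coset : List (ℕ × List ℕ))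
    (Mtab : List (List (List ℤ))) : List (List ℤ) × List (List ℕ) × List ℤ :=
  let N := n * E.length
  let rowPolys : List (List (List ℤ)) := rows.map fun r => Mtab.getD r []
  let Mpoly : List (List (List ℤ)) := (List.range n).map fun p =>
    let c := coset.getD p (0, [])
    (List.range n).map fun q => (rowPolys.getD c.1 []).getD (permAt c.2 q) []
  let evals : List (ℤ × List (List ℤ)) := (List.range (N + 1)).map fun x =>
    detAdjCols n (Mpoly.map fun row => row.map fun f => leval f (x : ℤ)) rows
  let d := interpolate0N (evals.map fun e => e.1)
  let Bcls : List (List ℤ) := (List.range rows.length).flatMap fun j =>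
    (List.range n).map fun i => interpolate0N (evals.map fun e => (e.2.getD j []).getD i 0)
  let Bidx : List (List ℕ) := (List.range n).map fun p =>
    let c := coset.getD p (0, [])
    (List.range n).map fun q => c.1 * n + permAt c.2 q
  (Bcls, Bidx, d)

/-- **The self-computing checker**: enumerate the rows, compute the certificate, run `checkSymCore`. [folklore] -/
def checkAuto (n : ℕ) (E : List (ℕ × ℕ)) (rows : List ℕ) (gens : List (List ℕ × List ℕ))
    (coset : List (ℕ × List ℕ)) : Bool :=
  let Mtab := rowTable n E rows
  let c := autoCert n E rows coset Mtab
  checkSymCore n E Mtab c.1 c.2.1 c.2.2 rows gens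

/-- **Soundness of `checkAuto`** (`checkSymCore` on computed data; the rows are true by
construction). [folklore] -/
theorem inv_entry_nonpos_of_checkAuto {n : ℕ} {E : List (ℕ × ℕ)} {rows : List ℕ}
    {gens : List (List ℕ × List ℕ)} {coset : List (ℕ × List ℕ)}
    (h : checkAuto n E rows gens coset = true) (K : ℝ) (hK : 0 ≤ K) (x y : Fin n) (hxy : x ≠ y) :
    (Matrix.of fun p q : Fin n => gksExpect Finset.univ (fun _ : Fin E.length => K) (edgeSet n E)
        (fun ω => spinAt p ω * spinAt q ω))⁻¹ x y ≤ 0 :=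
  inv_entry_nonpos_of_checkSymCore (Mtab := rowTable n E rows)
    (Bcls := (autoCert n E rows coset (rowTable n E rows)).1)
    (Bidx := (autoCert n E rows coset (rowTable n E rows)).2.1)
    (d := (autoCert n E rows coset (rowTable n E rows)).2.2) h
    (fun _ hp hpn _ hq v => leval_getPoly_rowTable hp hpn hq v) K hK x y hxy

end IsingPolynomial

end Literature.Probability.LatticeModels
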